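/-
Copyright (c) 2026 the pub-hodgecm-mathlib formalisation cell (harness21).  Prover seat hodgecm-mathlib-K2E1-p09 (g4), Track B ∕ K2-LIT,
h413 = `stmt-HodgeConjecture-24833`, line `K2_E1_TraceFormulaBeta`, campaign RES-RANK-ONE (toward (H4-b)): the CONSTANT TERM OF A PSEUDO-EISENSTEIN SERIES along
the same rank-one parabolic.  DEAL of the dealer K2E1-plan (g2) 2026-09-04T03:51:15Z.
-/
import Summits.HodgeConjecture.HodgeConjecture.Theorems.K2E1PseudoEisensteinAdjunction   -- ★ p856829 (F2a; F1 p856785 transitively): `tsum_quotient_mul_coe_eq`, `tsum_subgroupOf_swap`, the `Γ ⧸ Γ∩N` currency of `θ_Φ`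
import HarnessLib

/-!
# h413 ∕ Track B «K2-LIT», campaign RES-RANK-ONE — helper `K2E1PseudoEisensteinConstantTerm`:
# `CT(θ_Φ)(x) = ν(𝓕)·Σ_{t ∈ T(K)} Φ(x t) + Σ_{t ∈ T(K)} ∫_{N(𝔸)} Φ(x v t w₀) dν(v)` — «`(θ_Φ)_P = Φ_P + M(w₀)Φ`» in the rank-one case

Cell `pub/hodgecm-mathlib`, crux H413 = `stmt-HodgeConjecture-24833`, route `HCCMUnconditional`; chair K2-lead (g0), dealer K2E1-plan (g2).  THEOREMS ONLY (no
`def`, no `instance`, no `notation`, no named-fact hypothesis, no `sorry`); lane `--kind proof --supports stmt-HodgeConjecture-24833 --as helper` (count-neutral).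

GENERIC, in the currency of ★ F1 `K2E1PseudoEisensteinUnfolding`: `G` a second countable group, `Γ ≤ G` discrete, `N ≤ G` (the radical; `Γ ∩ N` acts on `N` by left
translation with a measurable fundamental domain `𝓕`, `ν` a left- and inversion-invariant measure on `N`), `Φ : G → [0, ∞]` Borel and RIGHT-`N`-INVARIANT, the
pseudo-Eisenstein series `θ_Φ(g) = Σ'_{q ∈ Γ ⧸ Γ∩N} Φ(g q̃)` and the constant term `CT_𝓕 ψ (x) = ∫_𝓕 ψ(x u⁻¹) dν(u)` (VERBATIM the ★ `ConstantTermVanishes` integrand).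
The GROUP-THEORETIC INPUT is the rank-one Bruhat decomposition in its coset form, taken as a HYPOTHESIS `e : ↥T × Option ↥(Γ∩N) ≃ Γ ⧸ Γ∩N`,
`e (t, none) = [t]`, `e (t, some n) = [n t w₀]` for a subgroup `T ≤ Γ` («`M(K)`») normalising `N` and an element `w₀ ∈ Γ`:
* §1 PURE GROUP THEORY `exists_equiv_prod_option_quotient`: the hypothesis `e` FOLLOWS from the Bruhat trichotomy `Γ = B ⊔ B w₀ N_Γ` (existence, disjointness,
  unique coordinates — ★ Literature `U2LocalBruhatDecomposition` ∕ `U3LocalBruhatDecompositionProofs`, ★ `K2E1BruhatCosetsU`) and the Levi decomposition `B = T·N_Γ`,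
  `T ∩ N_Γ = 1`, `T` normalising `N_Γ` (★ `isComplement'_torusU_unipotentU`, ★ `borelU_le_normalizer`); the rational unipotent is put FIRST in `n t w₀` so that no
  modulus character enters §2;
* §2 THE CONSTANT TERM **`setLIntegral_tsum_quotient_eq`**: for every `x ∈ G`,
  `∫⁻_{u ∈ 𝓕} θ_Φ(x u⁻¹) dν = ν(𝓕) · Σ'_{t ∈ T} Φ(x t) + Σ'_{t ∈ T} ∫⁻_{v ∈ N} Φ(x v t w₀) dν(v)`
  — small cell: `Φ(x u⁻¹ t) = Φ(x t · t⁻¹u⁻¹t) = Φ(x t)`; big cell: `Σ_{n ∈ Γ∩N} ∫_𝓕 Φ(x u⁻¹ n t w₀) du = ∫_N Φ(x v t w₀) dν(v)` by the periodisation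
  `N = ⊔_δ δ𝓕` (Mathlib `IsFundamentalDomain.lintegral_eq_tsum''`) and `v ↦ v⁻¹`; everything in `[0, ∞]` (Tonelli, no convergence hypothesis) [MW1995 II.1.7];
* §3 `setLIntegral_tsum_quotient_eq_of_bruhat`: §2 with `e` produced by §1 from the Bruhat ∕ Levi hypotheses.
The `U(Φ₂)` ∕ `U(Φ₃)` instances (transport of ★ `K2E1BruhatCosetsU` through `toAdelic`) are the sequel `K2E1PseudoEisensteinConstantTermU`.

HONEST LABEL.  Count-neutral helper; proves no printed statement; HC_CM is proved only modulo the 7 printed citations (2 remaining named inputs: hLiu418 =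
`stmt-HodgeConjecture-24832`, h413 = `stmt-HodgeConjecture-24833`) until rung 0 closes.

## References
* [MoeglinWaldspurger1995] C. Mœglin, J.-L. Waldspurger, *Spectral decomposition and Eisenstein series* (1995), II.1.7 (constant terms of (pseudo-)Eisenstein series), I.2.6.
* [Garrett2018] P. Garrett, *Modern Analysis of Automorphic Forms by Example* 1 (2018), §1.9.
* [Casselman1995] W. Casselman, *Introduction to the theory of admissible representations of p-adic reductive groups* (1995), Prop. 1.3.1, Prop. 1.3.3.
-/

set_option autoImplicit false
set_option linter.dupNamespace false  -- the mandated namespace repeats the summit's segment (`HodgeConjecture.HodgeConjecture`)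

noncomputable section
open MeasureTheory Measure Set Filter Topology
open Summit.HodgeConjecture.HodgeConjecture.Cruxes.H413.K2E1PseudoEisensteinUnfolding
open Summit.HodgeConjecture.HodgeConjecture.Cruxes.H413.K2E1PseudoEisensteinAdjunction (tsum_quotient_mul_coe_eq)
open scoped ENNReal NNReal Pointwise

namespace Summit.HodgeConjecture.HodgeConjecture.Cruxes.H413.K2E1PseudoEisensteinConstantTerm

/-! ## §1 Pure group theory: `Γ ⧸ N_Γ ≃ T × ({pt} ⊔ N_Γ)` from Bruhat + Levi -/

section Index

variable {Γ : Type*} [Group Γ] {B N T : Subgroup Γ} {w : Γ}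

/-- **THE INDEX SET OF A RANK-ONE PSEUDO-EISENSTEIN SERIES.**  In a group `Γ` with subgroups `N ≤ B`, `T ≤ B` and an element `w₀` such that (Bruhat) every element lies in
`B` or is `b w₀ n` (`b ∈ B`, `n ∈ N`), no `b w₀ n` lies in `B`, the coordinates `(b, n)` are unique, and (Levi) every `b ∈ B` is `t u` (`t ∈ T`, `u ∈ N`) with
`T ∩ N = 1` and `T` normalising `N`: the coset space `Γ ⧸ N` (cosets `γN`) is `{tN : t ∈ T} ⊔ {n t w₀ N : n ∈ N, t ∈ T}` with UNIQUE coordinates — an equivalence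
`e : ↥T × Option ↥N ≃ Γ ⧸ N`, `e (t, none) = [t]`, `e (t, some n) = [n t w₀]`. [cite: Casselman1995, Prop. 1.3.1, Prop. 1.3.3] [cite: MoeglinWaldspurger1995, II.1.7] -/
theorem exists_equiv_prod_option_quotient (hex : ∀ g : Γ, g ∈ B ∨ ∃ b ∈ B, ∃ n ∈ N, g = b * w * n)
    (hdisj : ∀ ⦃b n : Γ⦄, b ∈ B → n ∈ N → b * w * n ∉ B)
    (huniq : ∀ ⦃b b' n n' : Γ⦄, b ∈ B → b' ∈ B → n ∈ N → n' ∈ N → b * w * n = b' * w * n' → b = b' ∧ n = n')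
    (hNB : N ≤ B) (hTB : T ≤ B) (hLevi : ∀ b ∈ B, ∃ t ∈ T, ∃ u ∈ N, b = t * u) (hTN : ∀ ⦃g : Γ⦄, g ∈ T → g ∈ N → g = 1)
    (hnorm : ∀ ⦃t u : Γ⦄, t ∈ T → u ∈ N → t * u * t⁻¹ ∈ N) :
    ∃ e : ↥T × Option ↥N ≃ Γ ⧸ N, (∀ t : T, e (t, none) = ((t : Γ) : Γ ⧸ N)) ∧ ∀ (t : T) (n : N), e (t, some n) = (((n : Γ) * t * w : Γ) : Γ ⧸ N) := by
  let f : ↥T × Option ↥N → Γ ⧸ N := fun p => p.2.elim ((p.1 : Γ) : Γ ⧸ N) fun n => (((n : Γ) * p.1 * w : Γ) : Γ ⧸ N)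
  have hf1 : ∀ t : T, f (t, none) = ((t : Γ) : Γ ⧸ N) := fun _ => rfl
  have hf2 : ∀ (t : T) (n : N), f (t, some n) = (((n : Γ) * t * w : Γ) : Γ ⧸ N) := fun _ _ => rfl
  -- `[t] ≠ [n t' w]`
  have hne : ∀ (t t' : T) (n : N), ((t : Γ) : Γ ⧸ N) ≠ (((n : Γ) * t' * w : Γ) : Γ ⧸ N) := by
    intro t t' n h
    rw [QuotientGroup.eq] at h
    have hB : (n : Γ) * t' * w ∈ B := by
      have : (n : Γ) * t' * w = t * ((t : Γ)⁻¹ * ((n : Γ) * t' * w)) := by group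
      rw [this]; exact B.mul_mem (hTB t.2) (hNB h)
    exact hdisj (B.mul_mem (hNB n.2) (hTB t'.2)) N.one_mem (by rwa [mul_one])
  have hinj : Function.Injective f := by
    rintro ⟨t, _ | n⟩ ⟨t', _ | n'⟩ h
    · -- `[t] = [t']`
      change ((t : Γ) : Γ ⧸ N) = ((t' : Γ) : Γ ⧸ N) at h
      rw [QuotientGroup.eq] at h
      have h1 : (t : Γ)⁻¹ * t' = 1 := hTN (T.mul_mem (T.inv_mem t.2) t'.2) h
      rw [Prod.mk.injEq]
      exact ⟨Subtype.ext (inv_mul_eq_one.1 h1), rfl⟩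
    · exact absurd h (hne t t' n')
    · exact absurd h.symm (hne t' t n)
    · -- `[n t w] = [n' t' w]`
      change (((n : Γ) * t * w : Γ) : Γ ⧸ N) = (((n' : Γ) * t' * w : Γ) : Γ ⧸ N) at h
      rw [QuotientGroup.eq] at h
      set u : Γ := ((n : Γ) * t * w)⁻¹ * ((n' : Γ) * t' * w) with hu
      have hkey : (n' : Γ) * t' * w * 1 = (n : Γ) * t * w * u := by rw [hu, mul_one, mul_inv_cancel_left]
      obtain ⟨hb, -⟩ := huniq (B.mul_mem (hNB n'.2) (hTB t'.2)) (B.mul_mem (hNB n.2) (hTB t.2)) N.one_mem h hkey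
      -- `n' t' = n t ⟹ t = t'`, `n = n'`
      have htt : (t : Γ) * (t' : Γ)⁻¹ = (n : Γ)⁻¹ * n' :=
        calc (t : Γ) * (t' : Γ)⁻¹ = (n : Γ)⁻¹ * ((n : Γ) * t) * (t' : Γ)⁻¹ := by rw [inv_mul_cancel_left]
          _ = (n : Γ)⁻¹ * ((n' : Γ) * t') * (t' : Γ)⁻¹ := by rw [hb]
          _ = (n : Γ)⁻¹ * n' := by rw [mul_assoc, mul_inv_cancel_right]
      have h1 : (t : Γ) * (t' : Γ)⁻¹ = 1 := hTN (T.mul_mem t.2 (T.inv_mem t'.2)) (by rw [htt]; exact N.mul_mem (N.inv_mem n.2) n'.2)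
      have ht : t = t' := Subtype.ext (mul_inv_eq_one.1 h1)
      subst ht
      have hn : (n : Γ) = n' := (mul_right_cancel hb).symm
      rw [Subtype.ext hn]
  have hsurj : Function.Surjective f := by
    intro q
    induction q using QuotientGroup.induction_on with
    | H g =>
      rcases hex g with hg | ⟨b, hb, n, hn, rfl⟩
      · obtain ⟨t, ht, u, hu, rfl⟩ := hLevi g hg
        refine ⟨(⟨t, ht⟩, none), ?_⟩
        rw [hf1, QuotientGroup.eq]
        simpa using hu
      · obtain ⟨t, ht, u, hu, rfl⟩ := hLevi b hb
        refine ⟨(⟨t, ht⟩, some ⟨t * u * t⁻¹, hnorm ht hu⟩), ?_⟩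
        rw [hf2, QuotientGroup.eq]
        have : (t * u * t⁻¹ * t * w : Γ)⁻¹ * (t * u * w * n) = n := by group
        simpa only [this] using hn
  exact ⟨Equiv.ofBijective f ⟨hinj, hsurj⟩, hf1, hf2⟩

end Index

/-! ## §2 The constant term of `θ_Φ` along `N`, in `[0, ∞]` -/

section Option

/-- `Σ'_{o : Option α} f o = f none + Σ'_a f (some a)` in `[0, ∞]`. [folklore] -/
theorem tsum_option_eq {α : Type*} (f : Option α → ℝ≥0∞) : ∑' o, f o = f none + ∑' a, f (some a) := by
  rw [← (Equiv.optionEquivSumPUnit α : Option α ≃ α ⊕ PUnit.{1}).symm.tsum_eq f, ENNReal.summable.tsum_sum ENNReal.summable, add_comm]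
  simp

end Option

section ConstantTerm

variable {G : Type*} [Group G] (Γ N : Subgroup G)

/-- A right-`N`-invariant `Φ` does not see the choice of representative: `Φ(g · [γ].out) = Φ(g γ)` for `γ ∈ Γ`, `[γ] ∈ Γ ⧸ Γ∩N`. [folklore] -/
theorem apply_mul_out_mk_eq {Φ : G → ℝ≥0∞} (hΦ : ∀ (g : G) (n : N), Φ (g * n) = Φ g) (g : G) (γ : Γ) :
    Φ (g * (((QuotientGroup.mk γ : Γ ⧸ N.subgroupOf Γ).out : Γ) : G)) = Φ (g * (γ : G)) := by
  obtain ⟨h, hh⟩ := QuotientGroup.mk_out_eq_mul (N.subgroupOf Γ) γ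
  rw [hh, Subgroup.coe_mul, ← mul_assoc]
  exact hΦ (g * (γ : G)) ⟨((h : Γ) : G), h.2⟩

/-- **REINDEXING `θ_Φ` BY THE BRUHAT CELLS**: given the coset-form equivalence `e : ↥T × Option ↥(Γ∩N) ≃ Γ ⧸ Γ∩N` (`e (t, none) = [t]`, `e (t, some n) = [n t w₀]`),
`θ_Φ(g) = Σ'_{t ∈ T} ( Φ(g t) + Σ'_{n ∈ Γ∩N} Φ(g · n t w₀) )` for right-`N`-invariant `Φ ≥ 0`. [cite: MoeglinWaldspurger1995, II.1.7] -/
theorem tsum_quotient_eq_tsum_cells {Φ : G → ℝ≥0∞} (hΦ : ∀ (g : G) (n : N), Φ (g * n) = Φ g) {T : Subgroup Γ} {w : Γ}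
    (e : ↥T × Option ↥(N.subgroupOf Γ) ≃ Γ ⧸ N.subgroupOf Γ) (he₁ : ∀ t : T, e (t, none) = ((t : Γ) : Γ ⧸ N.subgroupOf Γ))
    (he₂ : ∀ (t : T) (n : N.subgroupOf Γ), e (t, some n) = (((n : Γ) * t * w : Γ) : Γ ⧸ N.subgroupOf Γ)) (g : G) :
    ∑' q : Γ ⧸ N.subgroupOf Γ, Φ (g * (q.out : G)) =
      ∑' t : T, (Φ (g * ((t : Γ) : G)) + ∑' n : N.subgroupOf Γ, Φ (g * (((n : Γ) : G) * ((t : Γ) : G) * (w : G)))) := by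
  rw [← e.tsum_eq, ENNReal.tsum_prod']
  refine tsum_congr fun t => ?_
  rw [tsum_option_eq]
  congr 1
  · rw [he₁, apply_mul_out_mk_eq Γ N hΦ]
  · refine tsum_congr fun n => ?_
    rw [he₂, apply_mul_out_mk_eq Γ N hΦ, Subgroup.coe_mul, Subgroup.coe_mul]

variable [TopologicalSpace G] [IsTopologicalGroup G] [MeasurableSpace G] [BorelSpace G] [SecondCountableTopology G] [DiscreteTopology Γ]
  (νN : Measure N) [νN.IsMulLeftInvariant] [νN.IsInvInvariant]

omit [TopologicalSpace G] [IsTopologicalGroup G] [BorelSpace G] [νN.IsMulLeftInvariant] [νN.IsInvInvariant] [DiscreteTopology Γ]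
  [SecondCountableTopology G] in
/-- **THE SMALL CELL**: for `t` normalising `N` (`t⁻¹ N t ⊆ N`) and right-`N`-invariant `Φ`, `∫⁻_{u ∈ 𝓕} Φ(x u⁻¹ t) dν(u) = ν(𝓕) · Φ(x t)` — the integrand is CONSTANT,
`Φ(x u⁻¹ t) = Φ(x t · (t⁻¹ u⁻¹ t))`. [cite: MoeglinWaldspurger1995, II.1.7] -/
theorem setLIntegral_smallCell_eq {Φ : G → ℝ≥0∞} (hΦ : ∀ (g : G) (n : N), Φ (g * n) = Φ g) {t : G} (ht : ∀ n : N, t⁻¹ * (n : G) * t ∈ N) (𝓕 : Set N) (x : G) :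
    ∫⁻ u in 𝓕, Φ (x * (u : G)⁻¹ * t) ∂νN = νN 𝓕 * Φ (x * t) := by
  have hpt : ∀ u : N, Φ (x * (u : G)⁻¹ * t) = Φ (x * t) := fun u => by
    have h1 : x * (u : G)⁻¹ * t = x * t * (t⁻¹ * ((u⁻¹ : N) : G) * t) := by rw [Subgroup.coe_inv]; group
    rw [h1]
    exact hΦ (x * t) ⟨_, ht u⁻¹⟩
  simp_rw [hpt]
  rw [setLIntegral_const, mul_comm]

omit [DiscreteTopology Γ] [SecondCountableTopology G] in
/-- **THE BIG CELL UNFOLDS**: `Σ'_{δ ∈ Γ∩N} ∫⁻_{u ∈ 𝓕} Φ(x u⁻¹ δ y) dν(u) = ∫⁻_N Φ(x v y) dν(v)` for a measurable fundamental domain `𝓕` of `Γ ∩ N` in `N` and every `y`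
(`δ ↦ δ⁻¹`, periodisation `N = ⊔_δ δ𝓕` — Mathlib `IsFundamentalDomain.lintegral_eq_tsum''` —, and `v ↦ v⁻¹` by inversion invariance). [cite: MoeglinWaldspurger1995, I.2.6, II.1.7] -/
theorem tsum_setLIntegral_bigCell_eq [Countable (Γ.subgroupOf N)] (Φ : G → ℝ≥0∞) {𝓕 : Set N}
    (h𝓕 : IsFundamentalDomain (Γ.subgroupOf N) 𝓕 νN) (x y : G) :
    ∑' δ : Γ.subgroupOf N, ∫⁻ u in 𝓕, Φ (x * (u : G)⁻¹ * ((δ : N) : G) * y) ∂νN = ∫⁻ v : N, Φ (x * (v : G) * y) ∂νN := by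
  haveI : MeasurableConstSMul (Γ.subgroupOf N) N := ⟨fun δ => measurable_const_mul (δ : N)⟩
  -- `δ ↦ δ⁻¹`
  rw [← (Equiv.inv (Γ.subgroupOf N)).tsum_eq]
  have hδ : ∀ (δ : Γ.subgroupOf N) (u : N), x * (u : G)⁻¹ * (((Equiv.inv (Γ.subgroupOf N) δ : Γ.subgroupOf N) : N) : G) * y =
      x * (((δ • u : N) : G))⁻¹ * y := fun δ u => by
    simp only [Equiv.inv_apply, Subgroup.smul_def, smul_eq_mul, Subgroup.coe_mul, Subgroup.coe_inv, mul_inv_rev, mul_assoc]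
  simp_rw [hδ]
  rw [← h𝓕.lintegral_eq_tsum'' (fun v : N => Φ (x * (v : G)⁻¹ * y)),
    ← lintegral_inv_eq_self (μ := νN) (fun v : N => Φ (x * (v : G) * y))]
  simp only [Subgroup.coe_inv]

/-- **THE CONSTANT TERM OF A PSEUDO-EISENSTEIN SERIES ALONG ITS OWN RADICAL** (rank one, `[0, ∞]`, no convergence hypothesis).  `Γ ≤ G` discrete, `N ≤ G` with a left- and
inversion-invariant measure `ν` and a measurable fundamental domain `𝓕` of `Γ ∩ N`; `Φ : G → [0,∞]` Borel right-`N`-invariant; `T ≤ Γ` with `t⁻¹ N t ⊆ N`; `w₀ ∈ Γ`; and the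
coset form `e : ↥T × Option ↥(Γ∩N) ≃ Γ ⧸ Γ∩N` of the Bruhat decomposition (`e (t,none) = [t]`, `e (t, some n) = [n t w₀]`, §1).  Then for every `x ∈ G`
  `∫⁻_{u ∈ 𝓕} θ_Φ(x u⁻¹) dν(u) = ν(𝓕) · Σ'_{t ∈ T} Φ(x t) + Σ'_{t ∈ T} ∫⁻_N Φ(x v t w₀) dν(v)`,
`θ_Φ(g) = Σ'_{q ∈ Γ ⧸ Γ∩N} Φ(g q̃)` — «`(θ_Φ)_P = Φ_P + M(w₀)Φ_P`» with the raw `T`-sums kept. [cite: MoeglinWaldspurger1995, II.1.7] [cite: Garrett2018, §1.9] -/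
theorem setLIntegral_tsum_quotient_eq {Φ : G → ℝ≥0∞} (hΦm : Measurable Φ) (hΦ : ∀ (g : G) (n : N), Φ (g * n) = Φ g)
    {T : Subgroup Γ} (hT : ∀ t ∈ T, ∀ n : N, ((t : G))⁻¹ * (n : G) * (t : G) ∈ N) {w : Γ}
    (e : ↥T × Option ↥(N.subgroupOf Γ) ≃ Γ ⧸ N.subgroupOf Γ) (he₁ : ∀ t : T, e (t, none) = ((t : Γ) : Γ ⧸ N.subgroupOf Γ))
    (he₂ : ∀ (t : T) (n : N.subgroupOf Γ), e (t, some n) = (((n : Γ) * t * w : Γ) : Γ ⧸ N.subgroupOf Γ))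
    {𝓕 : Set N} (h𝓕 : IsFundamentalDomain (Γ.subgroupOf N) 𝓕 νN) (x : G) :
    ∫⁻ u in 𝓕, (∑' q : Γ ⧸ N.subgroupOf Γ, Φ (x * (u : G)⁻¹ * (q.out : G))) ∂νN =
      νN 𝓕 * (∑' t : T, Φ (x * ((t : Γ) : G))) + ∑' t : T, ∫⁻ v : N, Φ (x * (v : G) * ((t : Γ) : G) * (w : G)) ∂νN := by
  -- `Γ ∩ N` is countable (★ F1 currency)
  haveI : Countable (Γ.subgroupOf N) :=
    Function.Injective.countable (f := fun δ : Γ.subgroupOf N => (⟨((δ : N) : G), δ.2⟩ : Γ))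
      fun a b h => Subtype.ext (Subtype.ext (congrArg (fun z : Γ => (z : G)) h))
  -- (a) reindex by the cells
  simp_rw [tsum_quotient_eq_tsum_cells Γ N hΦ e he₁ he₂]
  -- measurability of the pieces
  have hm1 : ∀ y : G, Measurable fun u : N => Φ (x * (u : G)⁻¹ * y) := fun y =>
    hΦm.comp ((measurable_const.mul measurable_subtype_coe.inv).mul measurable_const)
  have hm2 : ∀ t : T, Measurable fun u : N => ∑' n : N.subgroupOf Γ, Φ (x * (u : G)⁻¹ * (((n : Γ) : G) * ((t : Γ) : G) * (w : G))) := fun t => by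
    simp_rw [ENNReal.tsum_eq_iSup_sum]
    exact .iSup fun s => s.measurable_fun_sum fun n _ => hm1 _
  -- (b) Tonelli
  have htonelli : ∫⁻ u in 𝓕, ∑' t : T, (Φ (x * (u : G)⁻¹ * ((t : Γ) : G)) +
      ∑' n : N.subgroupOf Γ, Φ (x * (u : G)⁻¹ * (((n : Γ) : G) * ((t : Γ) : G) * (w : G)))) ∂νN =
      ∑' t : T, ∫⁻ u in 𝓕, (Φ (x * (u : G)⁻¹ * ((t : Γ) : G)) + ∑' n : N.subgroupOf Γ, Φ (x * (u : G)⁻¹ * (((n : Γ) : G) * ((t : Γ) : G) * (w : G)))) ∂νN :=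
    lintegral_tsum fun t => ((hm1 _).add (hm2 t)).aemeasurable
  rw [htonelli]
  simp_rw [lintegral_add_left (hm1 _)]
  rw [ENNReal.tsum_add]
  congr 1
  · -- (c) the small cell
    rw [← ENNReal.tsum_mul_left]
    refine tsum_congr fun t => ?_
    exact setLIntegral_smallCell_eq N νN hΦ (hT t t.2) 𝓕 x
  · -- (d) the big cell
    refine tsum_congr fun t => ?_
    have hton : ∫⁻ u in 𝓕, ∑' n : N.subgroupOf Γ, Φ (x * (u : G)⁻¹ * (((n : Γ) : G) * ((t : Γ) : G) * (w : G))) ∂νN =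
        ∑' n : N.subgroupOf Γ, ∫⁻ u in 𝓕, Φ (x * (u : G)⁻¹ * (((n : Γ) : G) * ((t : Γ) : G) * (w : G))) ∂νN :=
      lintegral_tsum fun n => (hm1 _).aemeasurable
    rw [hton]
    have hsw := tsum_subgroupOf_swap Γ N (fun y => ∫⁻ u in 𝓕, Φ (x * (u : G)⁻¹ * (y * ((t : Γ) : G) * (w : G))) ∂νN)
    rw [hsw]
    have hassoc : ∀ (δ : Γ.subgroupOf N) (u : N), x * (u : G)⁻¹ * (((δ : N) : G) * ((t : Γ) : G) * (w : G)) =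
        x * (u : G)⁻¹ * ((δ : N) : G) * (((t : Γ) : G) * (w : G)) := fun δ u => by simp only [mul_assoc]
    simp_rw [hassoc]
    rw [tsum_setLIntegral_bigCell_eq Γ N νN Φ h𝓕 x (((t : Γ) : G) * (w : G))]
    simp only [mul_assoc]

end ConstantTerm

/-! ## §3 From the Bruhat ∕ Levi hypotheses, and the spelling on `G ⧸ Γ` -/

section Assembly

variable {G : Type*} [Group G] [TopologicalSpace G] [IsTopologicalGroup G] [MeasurableSpace G] [BorelSpace G] [SecondCountableTopology G]
  (Γ N : Subgroup G) [DiscreteTopology Γ] (νN : Measure N) [νN.IsMulLeftInvariant] [νN.IsInvInvariant]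

/-- **THE CONSTANT TERM OF `θ_Φ`, FROM THE BRUHAT AND LEVI DECOMPOSITIONS OF `Γ`** (§2 with the index equivalence produced by §1): for subgroups `Γ ∩ N ≤ B`, `T ≤ B` of `Γ`
and `w₀ ∈ Γ` with `Γ = B ⊔ B w₀ (Γ∩N)` (existence ∕ disjointness ∕ unique coordinates), `B = T·(Γ∩N)`, `T ∩ N = 1` and `t⁻¹ N t ⊆ N` for `t ∈ T`:
`∫⁻_{u ∈ 𝓕} θ_Φ(x u⁻¹) dν = ν(𝓕)·Σ'_{t ∈ T} Φ(x t) + Σ'_{t ∈ T} ∫⁻_N Φ(x v t w₀) dν(v)`. [cite: MoeglinWaldspurger1995, II.1.7] [cite: Casselman1995, Prop. 1.3.1, Prop. 1.3.3] -/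
theorem setLIntegral_tsum_quotient_eq_of_bruhat {Φ : G → ℝ≥0∞} (hΦm : Measurable Φ) (hΦ : ∀ (g : G) (n : N), Φ (g * n) = Φ g)
    {B T : Subgroup Γ} {w : Γ} (hex : ∀ γ : Γ, γ ∈ B ∨ ∃ b ∈ B, ∃ n ∈ N.subgroupOf Γ, γ = b * w * n)
    (hdisj : ∀ ⦃b n : Γ⦄, b ∈ B → n ∈ N.subgroupOf Γ → b * w * n ∉ B)
    (huniq : ∀ ⦃b b' n n' : Γ⦄, b ∈ B → b' ∈ B → n ∈ N.subgroupOf Γ → n' ∈ N.subgroupOf Γ → b * w * n = b' * w * n' → b = b' ∧ n = n')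
    (hNB : N.subgroupOf Γ ≤ B) (hTB : T ≤ B) (hLevi : ∀ b ∈ B, ∃ t ∈ T, ∃ u ∈ N.subgroupOf Γ, b = t * u)
    (hTN : ∀ ⦃γ : Γ⦄, γ ∈ T → γ ∈ N.subgroupOf Γ → γ = 1) (hT : ∀ t ∈ T, ∀ n : N, ((t : G))⁻¹ * (n : G) * (t : G) ∈ N)
    {𝓕 : Set N} (h𝓕 : IsFundamentalDomain (Γ.subgroupOf N) 𝓕 νN) (x : G) :
    ∫⁻ u in 𝓕, (∑' q : Γ ⧸ N.subgroupOf Γ, Φ (x * (u : G)⁻¹ * (q.out : G))) ∂νN =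
      νN 𝓕 * (∑' t : T, Φ (x * ((t : Γ) : G))) + ∑' t : T, ∫⁻ v : N, Φ (x * (v : G) * ((t : Γ) : G) * (w : G)) ∂νN := by
  -- `T` normalises `Γ ∩ N` inside `Γ`
  have hnorm : ∀ ⦃t u : Γ⦄, t ∈ T → u ∈ N.subgroupOf Γ → t * u * t⁻¹ ∈ N.subgroupOf Γ := fun t u ht hu => by
    rw [Subgroup.mem_subgroupOf, Subgroup.coe_mul, Subgroup.coe_mul, Subgroup.coe_inv]
    have h := hT t⁻¹ (T.inv_mem ht) ⟨(u : G), hu⟩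
    rwa [Subgroup.coe_inv, inv_inv] at h
  obtain ⟨e, he₁, he₂⟩ := exists_equiv_prod_option_quotient hex hdisj huniq hNB hTB hLevi hTN hnorm
  exact setLIntegral_tsum_quotient_eq Γ N νN hΦm hΦ hT e he₁ he₂ h𝓕 x

/-- **THE SAME ON `X = G ⧸ Γ`** (the tree's spelling of `θ_Φ` through `Quotient.out`, ★ F2a `tsum_quotient_mul_coe_eq`): with `θ_Φ(y) = Σ'_q Φ(ỹ q̃)` for `y ∈ G ⧸ Γ`,
`CT_𝓕 θ_Φ (x) = ∫⁻_{u ∈ 𝓕} θ_Φ((x u⁻¹)Γ) dν(u) = ν(𝓕)·Σ'_{t ∈ T} Φ(x t) + Σ'_{t ∈ T} ∫⁻_N Φ(x v t w₀) dν(v)` — the left side is VERBATIM the ★ `ConstantTermVanishes`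
integrand applied to `θ_Φ`. [cite: MoeglinWaldspurger1995, II.1.7] [cite: Garrett2018, §1.9] -/
theorem setLIntegral_tsum_quotient_mk_eq {Φ : G → ℝ≥0∞} (hΦm : Measurable Φ) (hΦ : ∀ (g : G) (n : N), Φ (g * n) = Φ g)
    {T : Subgroup Γ} (hT : ∀ t ∈ T, ∀ n : N, ((t : G))⁻¹ * (n : G) * (t : G) ∈ N) {w : Γ}
    (e : ↥T × Option ↥(N.subgroupOf Γ) ≃ Γ ⧸ N.subgroupOf Γ) (he₁ : ∀ t : T, e (t, none) = ((t : Γ) : Γ ⧸ N.subgroupOf Γ))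
    (he₂ : ∀ (t : T) (n : N.subgroupOf Γ), e (t, some n) = (((n : Γ) * t * w : Γ) : Γ ⧸ N.subgroupOf Γ))
    {𝓕 : Set N} (h𝓕 : IsFundamentalDomain (Γ.subgroupOf N) 𝓕 νN) (x : G) :
    ∫⁻ u in 𝓕, (∑' q : Γ ⧸ N.subgroupOf Γ, Φ (((QuotientGroup.mk (x * (u : G)⁻¹) : G ⧸ Γ).out) * (q.out : G))) ∂νN =
      νN 𝓕 * (∑' t : T, Φ (x * ((t : Γ) : G))) + ∑' t : T, ∫⁻ v : N, Φ (x * (v : G) * ((t : Γ) : G) * (w : G)) ∂νN := by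
  have hout : ∀ u : N, ∑' q : Γ ⧸ N.subgroupOf Γ, Φ (((QuotientGroup.mk (x * (u : G)⁻¹) : G ⧸ Γ).out) * (q.out : G)) =
      ∑' q : Γ ⧸ N.subgroupOf Γ, Φ (x * (u : G)⁻¹ * (q.out : G)) := fun u => by
    obtain ⟨γ₀, hγ₀⟩ := QuotientGroup.mk_out_eq_mul Γ (x * (u : G)⁻¹)
    rw [hγ₀]
    exact tsum_quotient_mul_coe_eq Γ N hΦ (x * (u : G)⁻¹) γ₀
  simp_rw [hout]
  exact setLIntegral_tsum_quotient_eq Γ N νN hΦm hΦ hT e he₁ he₂ h𝓕 x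

end Assembly

end Summit.HodgeConjecture.HodgeConjecture.Cruxes.H413.K2E1PseudoEisensteinConstantTerm

end
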